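import Summits.BirchSwinnertonDyer.BirchSwinnertonDyer.Theorems.SignedLowerHalvesSmallImageLowerHalfBothSignsRttD2SeqSemilocExactCarrier
import Summits.BirchSwinnertonDyer.BirchSwinnertonDyer.Theorems.SignedLowerHalvesSmallImageLowerHalfBothSignsRttD2SeqSemilocLevelBound
import Literature.NumberTheory.GaloisRepresentations.DiscreteCochainsLongExact
import HarnessLib

/-!
# Route `SignedLowerHalves`, crux L `SmallImageLowerHalfBothSigns` (stmt-BirchSwinnertonDyer-23599), line `rtt_w3` v30 — stub S3β″ (`stub_junctionPT_ns`), input N5-(i), part 3b (levels):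
# (E1) EXACTNESS IN THE MIDDLE OF `H¹(Γ_{K_w}, Maps(Γ_K ⧸ U_n, ·))` ALONG `0 → X_j → X_{j+1} → X_1 → 0`, AND T5's `hfin ∧ htors` FOR THE CONSTRUCTED SEMILOCAL DATA

WIDTH seat `bsd-line-slh-p3-w3` g26 under LEAD `cruxlead-stmt-BirchSwinnertonDyer-23599` g14 (cell `bsd-ssimc`); helper `--supports stmt-BirchSwinnertonDyer-23599`. THEOREMS ONLY (no definition,
no named fact, no instance, no `sorry`). HONEST FRAMING: discharges hypothesis (E1) of `…RttD2SeqSemilocNakayama` (p817289) when `N_P` acts trivially on the coefficients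
(`hθN : θ′|_{N_P} = 1`, `hμN : N_P` fixes `μ_{p^∞}(K̄)` — then `X_k = 𝒪 ⊗ μ_{p^k}`), via the tree's long exact sequence for discrete modules over the compact group `Γ_{K_w}`
(`IsSES.exists_cohomologyMap_eq_of_cohomologyMap_eq_zero`) applied to the coefficient sequence of part 3b-carriers (p817892) coinduced to `Γ_K ⧸ U_n` and restricted to `Γ_{K_w}`; and
ASSEMBLES T5's hypotheses `hfin`/`htors` (p812244) for `Π_{w∈S₀} 𝐇¹_{Iw,w}` of the CONSTRUCTED semilocal data from parts 1–3 (Kőnig p817216, Nakayama p817289, incl/(E2) p817493, bound (B) p817727).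
The remaining displayed inputs are frame-level: `hθN`, `hμN`, `p ∉ w` and `w` finitely decomposed in `K_∞` (honda g28 `exists_toAdd_restrict_resGalOfEmb_ne_zero`) for `w ∈ S₀`.
Nothing about S3β″, crux L or BSD is proved; all remain OPEN and are proved for NO curve.

* §1 `semilocRedLE_one_eq_semilocCoeff_oMuPow` (the iterated reduction to level `1` is `H¹(res_w, Maps(id ⊗ ζ ↦ ζ^{p^j}))`).
* §2 ★★ `isSES_semiloc` (the coefficient sequence coinduced and restricted is a short exact sequence of discrete `Γ_{K_w}`-modules) and ★★★ `exists_semilocIncl_eq_of_semilocRedLE_eq_zero` ((E1)).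
* §3 ★★★ `moduleFinite_and_isTorsion_pi_semiloc` — `Module.Finite Λ (Π_{w:S₀} (semilocIwasawaCohomologyDataO … w 1).H) ∧ IsTorsion` from `hθN`, `hμN`, `p ∉ w`, finite decomposition.
References: [Shatz1972] Ch. II §1 Prop. 3; [NeukirchSchmidtWingberg2008] (1.3.2), (7.2.6), (8.6.2)–(8.6.3); [Washington1997] §13.2 Lemma 13.16; [Rubin2000] App. B.3; [PerrinRiou1994Invent] §1.3.
-/

set_option autoImplicit false
set_option linter.dupNamespace false -- D-0017: single-problem summit, the namespace repeats the problem name by design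
noncomputable section

open scoped Classical TensorProduct
open NumberField IsDedekindDomain Field CategoryTheory Function

namespace Summit.BirchSwinnertonDyer.BirchSwinnertonDyer.Theorems.SmallImageRttD2Seq

open Literature.NumberTheory.EllipticCurves Literature.NumberTheory.GaloisRepresentations Literature.NumberTheory.GaloisRepresentations.DiscreteGaloisModule
  Literature.NumberTheory.ComplexMultiplication.EllipticUnits.JohnsonLeungKings2011
  Summit.BirchSwinnertonDyer.BirchSwinnertonDyer.Theorems.SmallImageRttD2J1

section Levels

variable {K : Type} [Field K] [NumberField K] {p : ℕ} [Fact p.Prime] (S : Set (PadicAlgCl p)) [FiniteDimensional ℚ_[p] (padicCoeffField S)] (κ : ZpExtension K p)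
  (θ' : absoluteGaloisGroup K →ₜ* (padicCoeffIntegers S)ˣ) (P : Set (HeightOneSpectrum (𝓞 K))) (w : HeightOneSpectrum (𝓞 K))

/-! ## §1. The iterated reduction to level `1` as one coefficient map -/

omit [FiniteDimensional ℚ_[p] (padicCoeffField S)] in
/-- **`red_{j+1→1} = H^i(res_w, Maps(id ⊗ ζ ↦ ζ^{p^j}))`**: the iterated one-step reduction `semilocRedLE` from level `j+1` to level `1` is the coefficient map of `oMuPow j`.
[cite: Kato2004Asterisque, §8.2 (p. 180)] -/
theorem semilocRedLE_one_eq_semilocCoeff_oMuPow (i n j : ℕ) (z : semilocCoh S κ θ' P w n (j + 1) i) :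
    semilocRedLE S κ θ' P w i n (Nat.le_add_left 1 j) z = semilocCoeff S κ θ' P w n (oMuPow S j) (oMuPow_muTwistO S θ' j) i z := by
  induction j with
  | zero =>
    rw [semilocRedLE_refl]
    exact (semilocH_eq_self S κ θ' P w _ (fun φ ↦ funext fun y ↦ Subtype.ext (oMuPow_zero S ((φ y : (coeffRepK S θ' P (0 + 1)).toTopRep) : OMuCarrier K S (p ^ (0 + 1))))) i z).symm
  | succ j ih =>
    rw [semilocRedLE_succ S κ θ' P w i n (Nat.le_add_left 1 j), ih]
    unfold semilocRed semilocCoeff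
    exact (semilocH_comp_apply S κ θ' P w _ _ _ (fun φ ↦ funext fun y ↦ Subtype.ext
      (oMuPow_succ S j ((φ y : (coeffRepK S θ' P (j + 1 + 1)).toTopRep) : OMuCarrier K S (p ^ (j + 1 + 1))))) i z).symm

/-! ## §2. The short exact sequence of discrete `Γ_{K_w}`-modules and (E1) -/

omit [FiniteDimensional ℚ_[p] (padicCoeffField S)] in
/-- ★★ **`0 → Maps(Γ_K⧸U_n, X_j)|_w → Maps(Γ_K⧸U_n, X_{j+1})|_w → Maps(Γ_K⧸U_n, X_1)|_w → 0` is a short exact sequence of discrete `Γ_{K_w}`-modules** when `N_P` acts trivially on the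
coefficients (so `X_k = 𝒪 ⊗ μ_{p^k}`): pointwise the coefficient sequence of part 3b-carriers. [cite: Shatz1972, Ch. II §1 (1)] [cite: NeukirchSchmidtWingberg2008, (7.2.6), I §6] -/
theorem isSES_semiloc (hθN : ∀ g ∈ ramificationSubgroup K P, θ' g = 1) (hμN : ∀ (k : ℕ), ∀ g ∈ ramificationSubgroup K P, ∀ ζ : MuCarrier K (p ^ k), mu K (p ^ k) g ζ = ζ) (n j : ℕ) :
    haveI := ContinuousRep.discreteTopology_coindOpen (M := (coeffRepK S θ' P j).toTopRep) (κ.layerSubgroup n) (κ.isOpen_layerSubgroup n)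
    haveI := ContinuousRep.discreteTopology_coindOpen (M := (coeffRepK S θ' P (j + 1)).toTopRep) (κ.layerSubgroup n) (κ.isOpen_layerSubgroup n)
    haveI := ContinuousRep.discreteTopology_coindOpen (M := (coeffRepK S θ' P 1).toTopRep) (κ.layerSubgroup n) (κ.isOpen_layerSubgroup n)
    IsSES (ρ₁ := ((coeffRepK S θ' P j).coindOpen (κ.layerSubgroup n) (κ.isOpen_layerSubgroup n)).restrict (resGalOfEmb (closureEmb (K := K) (w.adicCompletion K))))
      (ρ₂ := ((coeffRepK S θ' P (j + 1)).coindOpen (κ.layerSubgroup n) (κ.isOpen_layerSubgroup n)).restrict (resGalOfEmb (closureEmb (K := K) (w.adicCompletion K))))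
      (ρ₃ := ((coeffRepK S θ' P 1).coindOpen (κ.layerSubgroup n) (κ.isOpen_layerSubgroup n)).restrict (resGalOfEmb (closureEmb (K := K) (w.adicCompletion K))))
      ((TopRep.resFunctor (resGalOfEmb (closureEmb (K := K) (w.adicCompletion K)) : absoluteGaloisGroup (w.adicCompletion K) →* absoluteGaloisGroup K)).map
        (coindFinMap (coeffHomK S θ' P (oMuIncl S j) (oMuIncl_muTwistO S θ' j)) (κ.layerSubgroup n)))
      ((TopRep.resFunctor (resGalOfEmb (closureEmb (K := K) (w.adicCompletion K)) : absoluteGaloisGroup (w.adicCompletion K) →* absoluteGaloisGroup K)).map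
        (coindFinMap (coeffHomK S θ' P (oMuPow S j) (oMuPow_muTwistO S θ' j)) (κ.layerSubgroup n))) := by
  haveI := ContinuousRep.discreteTopology_coindOpen (M := (coeffRepK S θ' P j).toTopRep) (κ.layerSubgroup n) (κ.isOpen_layerSubgroup n)
  haveI := ContinuousRep.discreteTopology_coindOpen (M := (coeffRepK S θ' P (j + 1)).toTopRep) (κ.layerSubgroup n) (κ.isOpen_layerSubgroup n)
  haveI := ContinuousRep.discreteTopology_coindOpen (M := (coeffRepK S θ' P 1).toTopRep) (κ.layerSubgroup n) (κ.isOpen_layerSubgroup n)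
  refine ⟨?_, ?_, ?_, ?_⟩
  · -- composite zero
    exact TopRep.hom_ext (ContIntertwiningMap.ext (ContinuousLinearMap.ext fun φ ↦ funext fun y ↦ Subtype.ext
      (oMuPow_oMuIncl S j ((φ y : (coeffRepK S θ' P j).toTopRep) : OMuCarrier K S (p ^ j)))))
  · -- injective
    intro φ ψ h
    funext y
    apply Subtype.ext
    apply oMuIncl_injective (K := K) S j
    have hy := congrFun h y
    exact congrArg Subtype.val hy
  · -- exact in the middle
    intro ψ hψ
    have hval : ∀ y, ∃ x : OMuCarrier K S (p ^ j), oMuIncl S j x = ((ψ y : (coeffRepK S θ' P (j + 1)).toTopRep) : OMuCarrier K S (p ^ (j + 1))) := fun y ↦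
      exists_oMuIncl_eq_of_oMuPow_eq_zero S j _ (congrArg Subtype.val (congrFun hψ y))
    choose x hx using hval
    refine ⟨fun y ↦ ⟨x y, mem_invariants_muTwistO_of_forall S θ' P j hθN (hμN j) _⟩, funext fun y ↦ Subtype.ext (hx y)⟩
  · -- surjective
    intro c
    have hval : ∀ y, ∃ x : OMuCarrier K S (p ^ (j + 1)), oMuPow S j x = ((c y : (coeffRepK S θ' P 1).toTopRep) : OMuCarrier K S (p ^ 1)) := fun y ↦
      oMuPow_surjective (K := K) S j _
    choose x hx using hval
    exact ⟨fun y ↦ ⟨x y, mem_invariants_muTwistO_of_forall S θ' P (j + 1) hθN (hμN (j + 1)) _⟩, funext fun y ↦ Subtype.ext (hx y)⟩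

omit [FiniteDimensional ℚ_[p] (padicCoeffField S)] in
/-- ★★★ **(E1) — exactness of `H¹(Γ_{K_w}, Maps(Γ_K ⧸ U_n, X_j)) → H¹(…, X_{j+1}) → H¹(…, X_1)` in the middle**: a class of `Lloc_w(n,j+1)` whose reduction to `Lloc_w(n,1)` vanishes is
`incl` of a class of `Lloc_w(n,j)` — hypothesis `hex` of `SemilocIwasawaCohomologyDataO.exists_nsmul_eq_of_forall_proj_one_eq_zero` / `moduleFinite_padicInt_of_levels`.
[cite: Shatz1972, Ch. II §1 Prop. 3] [cite: NeukirchSchmidtWingberg2008, (1.3.2), (7.2.6)] -/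
theorem exists_semilocIncl_eq_of_semilocRedLE_eq_zero (hθN : ∀ g ∈ ramificationSubgroup K P, θ' g = 1)
    (hμN : ∀ (k : ℕ), ∀ g ∈ ramificationSubgroup K P, ∀ ζ : MuCarrier K (p ^ k), mu K (p ^ k) g ζ = ζ) (n j : ℕ) (z : semilocCoh S κ θ' P w n (j + 1) 1)
    (hz : semilocRedLE S κ θ' P w 1 n (Nat.le_add_left 1 j) z = 0) : ∃ y, semilocIncl S κ θ' P w n j 1 y = z := by
  haveI : CompactSpace (absoluteGaloisGroup (w.adicCompletion K)) := absoluteGaloisGroup_compactSpace (w.adicCompletion K)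
  haveI := ContinuousRep.discreteTopology_coindOpen (M := (coeffRepK S θ' P j).toTopRep) (κ.layerSubgroup n) (κ.isOpen_layerSubgroup n)
  haveI := ContinuousRep.discreteTopology_coindOpen (M := (coeffRepK S θ' P (j + 1)).toTopRep) (κ.layerSubgroup n) (κ.isOpen_layerSubgroup n)
  haveI := ContinuousRep.discreteTopology_coindOpen (M := (coeffRepK S θ' P 1).toTopRep) (κ.layerSubgroup n) (κ.isOpen_layerSubgroup n)
  rw [semilocRedLE_one_eq_semilocCoeff_oMuPow] at hz
  obtain ⟨a, ha⟩ := (isSES_semiloc S κ θ' P w hθN hμN n j).exists_cohomologyMap_eq_of_cohomologyMap_eq_zero 1 z hz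
  exact ⟨a, ha⟩

/-! ## §3. T5's `hfin ∧ htors` for the constructed semilocal data -/

/-- ★★★ **T5's `hfin` AND `htors` FOR THE CONSTRUCTED SEMILOCAL IWASAWA DATA**: if `N_P` acts trivially on the coefficients (`θ′|_{N_P} = 1`, `N_P` fixes `μ_{p^∞}(K̄)`), and every
`w ∈ S₀` (finite) has `p ∉ w` and is finitely decomposed in `K_∞/K` (some `σ ∈ Γ_{K_w}` with `κ(res σ) = p^e·u₀`), then `Π_{w∈S₀} 𝐇¹_{Iw,w}` — the product of the CONSTRUCTED data
`semilocIwasawaCohomologyDataO S κ γ θ′ P w 1` — is finitely generated AND torsion over `Λ` (parts 1–3: Kőnig, Nakayama along the tower, `incl`/(E2), (E1), the levelwise bound (B)).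
[cite: Washington1997, §13.2 Lemma 13.16] [cite: NeukirchSchmidtWingberg2008, (5.3.10), (7.2.6), (8.6.2)–(8.6.3)] [cite: MilneADT2006, I §2 Thm. 2.8] [cite: Rubin2000, App. B.3] [cite: PerrinRiou1994Invent, §1.3] -/
theorem moduleFinite_and_isTorsion_pi_semiloc (γ : absoluteGaloisGroup K) (hθN : ∀ g ∈ ramificationSubgroup K P, θ' g = 1)
    (hμN : ∀ (k : ℕ), ∀ g ∈ ramificationSubgroup K P, ∀ ζ : MuCarrier K (p ^ k), mu K (p ^ k) g ζ = ζ)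
    (S₀ : Set (HeightOneSpectrum (𝓞 K))) (hS₀ : S₀.Finite) (hS₀p : ∀ w ∈ S₀, ((p : ℕ) : 𝓞 K) ∉ w.asIdeal)
    (hdec : ∀ w ∈ S₀, ∃ (σ : absoluteGaloisGroup (w.adicCompletion K)) (e : ℕ) (u₀ : ℤ_[p]ˣ),
      (κ (resGalOfEmb (closureEmb (K := K) (w.adicCompletion K)) σ)).toAdd = (p : ℤ_[p]) ^ e * u₀) :
    letI : ∀ w : HeightOneSpectrum (𝓞 K), Module (IwasawaAlgebra p) (semilocIwasawaCohomologyDataO S κ γ θ' P w 1).H :=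
      fun w ↦ (semilocIwasawaCohomologyDataO S κ γ θ' P w 1).moduleIwasawa
    Module.Finite (IwasawaAlgebra p) (∀ w : S₀, (semilocIwasawaCohomologyDataO S κ γ θ' P w 1).H) ∧
      Module.IsTorsion (IwasawaAlgebra p) (∀ w : S₀, (semilocIwasawaCohomologyDataO S κ γ θ' P w 1).H) :=
  moduleFinite_and_isTorsion_pi_of_levels S₀ hS₀ (fun w ↦ semilocIwasawaCohomologyDataO S κ γ θ' P w 1) (fun w _ n k ↦ finite_semilocCoh_one S κ θ' P w n k)
    (fun w _ ↦ ⟨fun n j ↦ semilocIncl S κ θ' P w n j 1, fun n j y ↦ semilocCores_semilocIncl S κ θ' P w n j 1 y, fun n j y ↦ semilocRed_semilocIncl S κ θ' P w n j 1 y,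
      fun n j z ↦ nsmul_eq_semilocIncl_semilocRed S κ θ' P w n j 1 z, fun n j z hz ↦ exists_semilocIncl_eq_of_semilocRedLE_eq_zero S κ θ' P w hθN hμN n j z hz⟩)
    (fun w hw ↦ by
      obtain ⟨σ, e, u₀, hσ⟩ := hdec w hw
      exact exists_bound_semilocCoh_one S κ θ' P w (hS₀p w hw) hσ)

end Levels

end Summit.BirchSwinnertonDyer.BirchSwinnertonDyer.Theorems.SmallImageRttD2Seq

end
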